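import Summits.QuantumFields.GaugeBoot.StrongCouplingWilsonLoopDecay
import Summits.QuantumFields.GaugeBoot.StrongCouplingPlaquetteDLRWindow
import Summits.QuantumFields.GaugeBoot.LimitPoints
import HarnessLib

/-!
# Strong coupling from the loop equation: the all-order decay of Wilson loops at every infinite-volume limit point (gauge-boot, ADDENDUM 26 part D)

HONEST FRAMING (cell `pub-gaugeboot`, page 1 of every file): the venture produces certified bounds
on lattice expectations at stated coupling, gauge group, dimension and torus size; NOT a mass gap,
NOT a continuum limit, NOT a string tension; NOT Yang–Mills-summit-bearing (barriers
`FixedCouplingUltralocality`, `PerturbativeInvisibility`).  Analytic strong-coupling bounds, uniform in the volume, hence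
valid at every thermodynamic limit point; NOT an area law (perimeter-rate exponent), no string tension is bounded; no
uniqueness of the limit is claimed or used; no number of CERTIFIED.md is touched.

## Content (`SU(N)`, `N ≥ 2`, fundamental representation, `D ≥ 2`, tree coupling `β_std/N`)

The torus bounds of `StrongCouplingWilsonLoopDecay` hold for EVERY torus side `L ≥ max(R, T) + 2`, so they pass to every
`μ ∈ infiniteVolumeLimitPoints (suRep N) (β_std/N)` (weak limits of the bounded continuous cylinder observable
`wilsonLoopObs ((1/N)Re tr ∘ ρ) (rectWalk 0 i j R T)`, whose restriction to a torus is the torus Wilson loop, which has the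
expectation of the torus-averaged loop):

* `abs_rectExpectation_le_of_forall` — the transfer lemma: a uniform-in-`L` bound `|wilsonLoopExpectation N D L β_std R T| ≤ b`
  for `L ≥ L₀` is a bound `|W_μ(R × T)| ≤ b` for the tree's `rectExpectation` of every limit point, in every plane `i ≠ j`;
* ★★★ `abs_rectExpectation_le_pow_of_mem_limitPoints` — **`|W_μ(R × T)| ≤ (4(D−1)|β_std|/(N²−1))^{2(R+T)−4}`** for every
  limit point, every plane, every `R, T ≥ 2`, every real `β_std`; ★★ `_le_pow_fst / _le_pow_snd` — `≤ (…)^R`, `≤ (…)^T` for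
  `R, T ≥ 1`; `SU(3)`, `D = 4`: `(3|β|/2)^{2(R+T)−4}`;
* ★★★ `abs_rectExpectation_le_pow_of_mem_ymGibbsMeasures` — in the tree's Dobrushin window `6(D−1)|β_std| < 1`, where every
  DLR state is a limit point (`mem_limitPoints_of_mem_ymGibbsMeasures_of_small`), the same for EVERY DLR state
  `μ ∈ 𝒢(β_std/N)` on `ℤ^D` (there `4(D−1)|β_std|/(N²−1) < 2/(3(N²−1)) ≤ 2/9`: a genuine geometric decay in the perimeter).

References: as in parts A–C.  Everything is `[folklore]`.
-/

noncomputable section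

open MeasureTheory Filter Topology
open Literature.MathematicalPhysics.QuantumFieldTheory
open Literature.MathematicalPhysics.QuantumLattice (LGConfig IsCylinder IsInfiniteVolumeLimitAlong infiniteVolumeLimitPoints
  ymGibbsMeasures wilsonLoopObs rectWalk rectExpectation loopExpectation isCylinder_wilsonLoopObs continuous_wilsonLoopObs
  exists_abs_wilsonLoopObs_le normalisedCharacter continuous_normalisedCharacter_comp)
open Literature.Probability.LatticeModels (Torus.proj)

namespace Summit.QuantumFields.GaugeBoot

namespace StrongCoupling

/-- **Transfer lemma (rectangular loops).**  If `|wilsonLoopExpectation N D L β_std R T| ≤ b` for every torus side `L ≥ L₀`,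
then for every `μ ∈ infiniteVolumeLimitPoints (suRep N) (β_std/N)` and every plane `i ≠ j` of `ℤ^D`: `|W_μ(R × T)| ≤ b`
for the tree's `rectExpectation μ ((1/N)Re tr ∘ suRep N) i j R T` (weak convergence of the loop cylinder observable along the
subsequence; `⟨W_x(R×T)⟩_L = ⟨W̄(R×T)⟩_L` on every torus). [folklore] -/
theorem abs_rectExpectation_le_of_forall {N D : ℕ} (β : ℝ) {R T L₀ : ℕ} {b : ℝ}
    (hb : ∀ (L : ℕ) [NeZero L], L₀ ≤ L → |wilsonLoopExpectation N D L β R T| ≤ b)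
    {μ : Measure (LGConfig D (SU N))} (hμ : μ ∈ infiniteVolumeLimitPoints (d := D) (suRep N) (β / N))
    {i j : Fin D} (hij : i ≠ j) :
    |rectExpectation μ (normalisedCharacter N ∘ suRep N) i j R T| ≤ b := by
  obtain ⟨Lk, hmono, hlim⟩ := hμ
  have hχ := continuous_normalisedCharacter_comp (N := N) (continuous_suRep N)
  have ht := hlim.2 _ _ (isCylinder_wilsonLoopObs (normalisedCharacter N ∘ suRep N) (rectWalk 0 i j R T))
    (continuous_wilsonLoopObs hχ _) (exists_abs_wilsonLoopObs_le hχ _)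
  simp only [toTorusObservable_wilsonLoopObs_rectWalk] at ht
  have hev : ∀ᶠ k in atTop,
      |wilsonExpectation (suRep N) (β / N) (wilsonLoop (suRep N) (Torus.proj (Lk k + 1) 0) i j R T)| ≤ b := by
    refine Filter.eventually_atTop.2 ⟨L₀, fun k hk => ?_⟩
    have hL : L₀ ≤ Lk k + 1 := (hk.trans (hmono.id_le k)).trans (Nat.le_succ _)
    rw [← wilsonExpectation_wordLoop_rectangle, ← wilsonLoopExpectation_eq_wordLoop N D (Lk k + 1) β R T _ hij]
    exact hb (Lk k + 1) hL
  unfold rectExpectation loopExpectation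
  rw [abs_le]
  exact ⟨ge_of_tendsto ht (hev.mono fun k hk => (abs_le.1 hk).1), le_of_tendsto ht (hev.mono fun k hk => (abs_le.1 hk).2)⟩

/-- ★★★ **ALL-ORDER STRONG-COUPLING DECAY OF WILSON LOOPS AT EVERY INFINITE-VOLUME LIMIT POINT** (`SU(N)`, `N ≥ 2`, `D ≥ 2`,
EVERY real `β_std`): for every `μ ∈ infiniteVolumeLimitPoints (suRep N) (β_std/N)`, every plane `i ≠ j` and every `R, T ≥ 2`,
`|W_μ(R × T)| ≤ (4(D−1)|β_std|/(N²−1))^{2(R+T)−4}`. [folklore] -/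
theorem abs_rectExpectation_le_pow_of_mem_limitPoints {N D : ℕ} (hN : 2 ≤ N) (hD : 2 ≤ D) (β : ℝ)
    {μ : Measure (LGConfig D (SU N))} (hμ : μ ∈ infiniteVolumeLimitPoints (d := D) (suRep N) (β / N))
    {i j : Fin D} (hij : i ≠ j) {R T : ℕ} (hR : 2 ≤ R) (hT : 2 ≤ T) :
    |rectExpectation μ (normalisedCharacter N ∘ suRep N) i j R T| ≤
      (4 * ((D : ℝ) - 1) * |β| / ((N : ℝ) ^ 2 - 1)) ^ (2 * (R + T) - 4) :=
  abs_rectExpectation_le_of_forall β (L₀ := R + T + 2)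
    (fun L _ hL => abs_wilsonLoopExpectation_le_pow hN hD hR (by omega) hT (by omega) β) hμ hij

/-- ★★ **`|W_μ(R × T)| ≤ (4(D−1)|β_std|/(N²−1))^R`** at every limit point (`R, T ≥ 1`). [folklore] -/
theorem abs_rectExpectation_le_pow_fst_of_mem_limitPoints {N D : ℕ} (hN : 2 ≤ N) (hD : 2 ≤ D) (β : ℝ)
    {μ : Measure (LGConfig D (SU N))} (hμ : μ ∈ infiniteVolumeLimitPoints (d := D) (suRep N) (β / N))
    {i j : Fin D} (hij : i ≠ j) {R T : ℕ} (hR : 1 ≤ R) (hT : 1 ≤ T) :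
    |rectExpectation μ (normalisedCharacter N ∘ suRep N) i j R T| ≤ (4 * ((D : ℝ) - 1) * |β| / ((N : ℝ) ^ 2 - 1)) ^ R :=
  abs_rectExpectation_le_of_forall β (L₀ := R + T + 1)
    (fun L _ hL => abs_wilsonLoopExpectation_le_pow_fst hN hD hR (by omega) hT (by omega) β) hμ hij

/-- ★★ **`|W_μ(R × T)| ≤ (4(D−1)|β_std|/(N²−1))^T`** at every limit point (`R, T ≥ 1`) — for `R = 1` the exponent is the
area. [folklore] -/
theorem abs_rectExpectation_le_pow_snd_of_mem_limitPoints {N D : ℕ} (hN : 2 ≤ N) (hD : 2 ≤ D) (β : ℝ)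
    {μ : Measure (LGConfig D (SU N))} (hμ : μ ∈ infiniteVolumeLimitPoints (d := D) (suRep N) (β / N))
    {i j : Fin D} (hij : i ≠ j) {R T : ℕ} (hR : 1 ≤ R) (hT : 1 ≤ T) :
    |rectExpectation μ (normalisedCharacter N ∘ suRep N) i j R T| ≤ (4 * ((D : ℝ) - 1) * |β| / ((N : ℝ) ^ 2 - 1)) ^ T :=
  abs_rectExpectation_le_of_forall β (L₀ := R + T + 1)
    (fun L _ hL => abs_wilsonLoopExpectation_le_pow_snd hN hD hR (by omega) hT (by omega) β) hμ hij

/-- ★★★ **… AND FOR EVERY DLR STATE IN THE UNIQUENESS WINDOW**: for `6(D−1)|β_std| < 1`, every `μ ∈ 𝒢(β_std/N)` on `ℤ^D`,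
every plane `i ≠ j` and every `R, T ≥ 2`: `|W_μ(R × T)| ≤ (4(D−1)|β_std|/(N²−1))^{2(R+T)−4}`. [folklore] -/
theorem abs_rectExpectation_le_pow_of_mem_ymGibbsMeasures {N D : ℕ} (hN : 2 ≤ N) (hD : 2 ≤ D) {β : ℝ}
    (hβ : 6 * ((D : ℝ) - 1) * |β| < 1) {μ : Measure (LGConfig D (SU N))}
    (hμ : μ ∈ ymGibbsMeasures (d := D) (suRep N) (β / N)) {i j : Fin D} (hij : i ≠ j) {R T : ℕ} (hR : 2 ≤ R) (hT : 2 ≤ T) :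
    |rectExpectation μ (normalisedCharacter N ∘ suRep N) i j R T| ≤
      (4 * ((D : ℝ) - 1) * |β| / ((N : ℝ) ^ 2 - 1)) ^ (2 * (R + T) - 4) :=
  abs_rectExpectation_le_pow_of_mem_limitPoints hN hD β
    (mem_limitPoints_of_mem_ymGibbsMeasures_of_small (by omega) (by omega) hβ hμ) hij hR hT

/-- ★★ **`|W_μ(R × T)| ≤ (4(D−1)|β_std|/(N²−1))^T` for every DLR state in the window** (`R, T ≥ 1`). [folklore] -/
theorem abs_rectExpectation_le_pow_snd_of_mem_ymGibbsMeasures {N D : ℕ} (hN : 2 ≤ N) (hD : 2 ≤ D) {β : ℝ}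
    (hβ : 6 * ((D : ℝ) - 1) * |β| < 1) {μ : Measure (LGConfig D (SU N))}
    (hμ : μ ∈ ymGibbsMeasures (d := D) (suRep N) (β / N)) {i j : Fin D} (hij : i ≠ j) {R T : ℕ} (hR : 1 ≤ R) (hT : 1 ≤ T) :
    |rectExpectation μ (normalisedCharacter N ∘ suRep N) i j R T| ≤ (4 * ((D : ℝ) - 1) * |β| / ((N : ℝ) ^ 2 - 1)) ^ T :=
  abs_rectExpectation_le_pow_snd_of_mem_limitPoints hN hD β
    (mem_limitPoints_of_mem_ymGibbsMeasures_of_small (by omega) (by omega) hβ hμ) hij hR hT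

/-- `SU(3)`, `D = 4`: `|W_μ(R × T)| ≤ (3|β|/2)^{2(R+T)−4}` at every limit point, `R, T ≥ 2`. [folklore] -/
theorem abs_rectExpectation_three_four_le_pow_of_mem_limitPoints (β : ℝ) {μ : Measure (LGConfig 4 (SU 3))}
    (hμ : μ ∈ infiniteVolumeLimitPoints (d := 4) (suRep 3) (β / 3)) {i j : Fin 4} (hij : i ≠ j) {R T : ℕ} (hR : 2 ≤ R)
    (hT : 2 ≤ T) : |rectExpectation μ (normalisedCharacter 3 ∘ suRep 3) i j R T| ≤ (3 * |β| / 2) ^ (2 * (R + T) - 4) := by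
  have h := abs_rectExpectation_le_pow_of_mem_limitPoints (N := 3) (D := 4) (by norm_num) (by norm_num) β
    (by exact_mod_cast hμ) hij hR hT
  norm_num at h
  convert h using 2
  ring

end StrongCoupling

end Summit.QuantumFields.GaugeBoot

end
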